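import Summits.QuantumFields.BalabanUV.T4Continuum.Support.RegionCornerCoupling

/-!
# T⁴ programme, spine node NE2 (U1a), sub-row Δ1 «NE2⁰-Dirichlet» — THE CORNER COUPLING IS SUPPORTED ON THE CORNER BONDS (operator form):
# `C = P_corner·C·P_corner`, `C v = 0` for every `v` vanishing on the corner bonds, `‖C u‖² ≤ ((d − 1)n²)²·Σ_corner ‖u‖²` (`2 ≤ n`, any union of blocks)

NE2 formalisation swarm `b2b-balaban-t4-ne2-formalise-*`, LEAF PROVER 02 (gen 9), support item «Δ1-CORNER-COUPLING», file 3 (files 1–2: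
`Support/RegionExteriorFlux`, `Support/RegionCornerCoupling` — the two-sided form bounds `−(d − 1)·n²·Σ_corner ‖A‖² ≤ re⟨A, C A⟩ ≤ n²·Σ_corner ‖A‖²`
and `‖C‖ ≤ (d − 1)·n²`).  The row-NE2 owner's ruling R37 (e) (i) says the corner coupling of `Δ_loc = Σ_μ W_μ + C + a n^d·avgRᴴavgR` is «supported
on the codimension-2 contact set»; a pairing / commutator estimate on the re-entrant front needs this as an OPERATOR statement (`C = C·P_corner`),
not only as a statement about the quadratic form.  THIS FILE derives the operator statement from the form bounds ALONE, by a positivity argument: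

 * §0 generic finite-dimensional linear algebra ([folklore]): **`mulVec_eq_zero_of_re_form_eq_zero`** — a Hermitian `N ≥ 0` with `re⟨v, Nv⟩ = 0`
   has `Nv = 0` —; **`mulVec_eq_zero_of_weighted_form`** — if `Y` is Hermitian and `−α·Σ_i ρ_i‖w_i‖² ≤ re⟨w, Yw⟩ ≤ β·Σ_i ρ_i‖w_i‖²` for all `w`
   (any real `α, β, ρ`), then every `v` vanishing on `supp ρ` lies in `ker Y` (apply the first lemma to `N = Y + α·diag ρ ≥ 0`) —, and the row
   version `mulVec_apply_eq_zero_of_weighted_form` (`(Yu)_i = 0` off `supp ρ`, by Hermitian symmetry).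
 * §1 for the corner coupling at `2 ≤ n` (`ρ = cornerWt ∈ {0, 1}`, `α = (d − 1)n²`, `β = n²` from file 2): **`cornerC_mulVec_eq_zero_of_vanish`**,
   **`cornerC_mulVec_apply_eq_zero`**, the entrywise support `cornerC_apply_eq_zero_left/right`, the corner projection **`cornerP = diag(cornerWt)`**
   with **`cornerC_eq_proj_mul_proj : cornerC = cornerP * cornerC * cornerP`**, `cornerC_mulVec_eq_mulVec_proj` (`C u = C (P u)`),
   `cornerP_mulVec_cornerC_mulVec` (`P (C u) = C u`), `form_cornerC_eq_proj`, and THE END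
   **`nsq_cornerC_mulVec_le (hn : 2 ≤ n) : ‖C u‖² ≤ ((d − 1)·n²)²·Σ_y cornerWt y·‖u y‖²`** — the corner coupling reads, and returns, the corner
   restriction only.

HONEST FRAMING (T4-DAG p. 1).  Lattice bookkeeping at MODEL level (`U = 1`, ONE region, finite torus); statements and constants OURS ([folklore]);
obstruction (i) of the re-entrant front only — no Hessian budget, no W2, no two-level law and no tower on re-entrant regions is claimed; W3 on boxes
OPEN; Δ1 NOT closed; NE2 (U1a) NOT proved; spine PROVED 0/9 unchanged; NOT [B9] (3.16)/(3.23)–(3.27) as printed; NOT infinite volume, NOT a mass gap,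
NOT the Clay problem.  HONEST DEPENDENCY: continuum YM on T⁴ ⇐ BetaPertH ∧ nine spine estimates (0/9 proved); BetaPertH ⇐ (D1) ∧ (D4) ∧ CAP+tail;
G-an2-4 gates asym, D1 and NE2/3/4.  No `sorry`.
-/

noncomputable section

open scoped BigOperators ComplexConjugate Matrix Matrix.Norms.L2Operator
open Finset

namespace Summit.QuantumFields.BalabanUV.T4Continuum.RegionCornerCouplingSupport

open Literature.MathematicalPhysics.QuantumFieldTheory.Balaban1983to89.B5Prop11Plancherel (Tor fine unitVec)
open Literature.MathematicalPhysics.QuantumFieldTheory.Balaban1983to89.B5Prop11Lower (nsq nsq_nonneg star_dotProduct_self nsq_mulVec_le)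
open Summit.QuantumFields.BalabanUV.T4Continuum
open Summit.QuantumFields.BalabanUV.T4Continuum.SubtypeCompression (eq_zero_of_nsq_eq_zero)
open Summit.QuantumFields.BalabanUV.T4Continuum.RegionGaugeFixedVector (starReg)
open Summit.QuantumFields.BalabanUV.T4Continuum.RegionElectricSplitting (form_diagonal_ofReal)
open Summit.QuantumFields.BalabanUV.T4Continuum.RegionElectricGeneral (cornerC cornerC_isHermitian)
open Summit.QuantumFields.BalabanUV.T4Continuum.RegionExteriorFlux (bdW)
open Summit.QuantumFields.BalabanUV.T4Continuum.RegionCornerCoupling (cornerWt cornerWt_nonneg form_cornerC_le form_cornerC_ge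
  opNorm_cornerC_le)
open Summit.QuantumFields.BalabanUV.T4Continuum.InverseComparison (re_form_sub_smul)
open Summit.QuantumFields.BalabanUV.Beta.GAN24.DirichletBoxTrace (blockReg)

variable {d : ℕ}

/-! ## §0 Positivity: the kernel of a form controls the kernel of the operator -/

section Generic

variable {m : Type*} [Fintype m] [DecidableEq m]

omit [DecidableEq m] in
/-- **PSD KERNEL**: a Hermitian `N` with nonnegative form and `re⟨v, Nv⟩ = 0` has `Nv = 0` (`0 ≤ Q(v − tu) = −2t·re⟨v, Nu⟩ + t²Q(u)` for all real
`t` forces `re⟨v, Nu⟩ = 0`; take `u = Nv`). [folklore] -/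
theorem mulVec_eq_zero_of_re_form_eq_zero {N : Matrix m m ℂ} (hN : N.IsHermitian) (hpos : ∀ w, 0 ≤ (star w ⬝ᵥ (N *ᵥ w)).re)
    {v : m → ℂ} (hv : (star v ⬝ᵥ (N *ᵥ v)).re = 0) : N *ᵥ v = 0 := by
  have key : ∀ u, (star v ⬝ᵥ (N *ᵥ u)).re = 0 := by
    intro u
    set r := (star v ⬝ᵥ (N *ᵥ u)).re with hr
    set q := (star u ⬝ᵥ (N *ᵥ u)).re with hq
    have hq0 : 0 ≤ q := hpos u
    have h : ∀ t : ℝ, 0 ≤ -(2 * t * r) + t ^ 2 * q := by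
      intro t
      have := hpos (v - (t : ℂ) • u)
      rw [re_form_sub_smul hN, hv] at this
      linarith
    have hq1 : 0 < q + 1 := by linarith
    have h1 := h (r / (q + 1))
    have e : -(2 * (r / (q + 1)) * r) + (r / (q + 1)) ^ 2 * q = -(r ^ 2 * (q + 2)) / (q + 1) ^ 2 := by
      field_simp
      ring
    rw [e] at h1
    have h3 : 0 ≤ -(r ^ 2 * (q + 2)) := by
      have := mul_nonneg h1 (sq_nonneg (q + 1))
      rwa [div_mul_cancel₀ _ (ne_of_gt (pow_pos hq1 2))] at this
    nlinarith [sq_nonneg r]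
  have h2 : nsq (N *ᵥ v) = 0 := by
    have e : star (N *ᵥ v) ⬝ᵥ (N *ᵥ v) = star v ⬝ᵥ (N *ᵥ (N *ᵥ v)) := by
      rw [Matrix.star_mulVec, hN.eq, ← Matrix.dotProduct_mulVec]
    have := key (N *ᵥ v)
    rwa [← e, star_dotProduct_self, Complex.ofReal_re] at this
  exact eq_zero_of_nsq_eq_zero h2

/-- **SUPPORT FROM TWO-SIDED WEIGHTED FORM BOUNDS**: `Y` Hermitian, `−α·Σ_i ρ_i‖w_i‖² ≤ re⟨w, Yw⟩ ≤ β·Σ_i ρ_i‖w_i‖²` for all `w` (any real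
`α, β, ρ`); then every `v` vanishing on `supp ρ` is in `ker Y` (`N = Y + α·diag ρ ≥ 0` has `re⟨v, Nv⟩ = 0`). [folklore] -/
theorem mulVec_eq_zero_of_weighted_form {Y : Matrix m m ℂ} (hY : Y.IsHermitian) {ρ : m → ℝ} {α β : ℝ}
    (hup : ∀ w, (star w ⬝ᵥ (Y *ᵥ w)).re ≤ β * ∑ i, ρ i * ‖w i‖ ^ 2)
    (hlo : ∀ w, -(α * ∑ i, ρ i * ‖w i‖ ^ 2) ≤ (star w ⬝ᵥ (Y *ᵥ w)).re)
    {v : m → ℂ} (hv : ∀ i, ρ i ≠ 0 → v i = 0) : Y *ᵥ v = 0 := by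
  set D : Matrix m m ℂ := Matrix.diagonal (fun i => ((α * ρ i : ℝ) : ℂ)) with hD
  set N := Y + D with hN
  have hDh : D.IsHermitian := Matrix.isHermitian_diagonal_iff.mpr fun i => by simp [isSelfAdjoint_iff]
  have hNh : N.IsHermitian := hY.add hDh
  have hformD : ∀ w, (star w ⬝ᵥ (D *ᵥ w)).re = α * ∑ i, ρ i * ‖w i‖ ^ 2 := fun w => by
    rw [hD, form_diagonal_ofReal, Complex.ofReal_re, mul_sum]
    exact sum_congr rfl fun i _ => by ring
  have hformN : ∀ w, (star w ⬝ᵥ (N *ᵥ w)).re = (star w ⬝ᵥ (Y *ᵥ w)).re + α * ∑ i, ρ i * ‖w i‖ ^ 2 := fun w => by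
    rw [hN, Matrix.add_mulVec, dotProduct_add, Complex.add_re, hformD]
  have hpos : ∀ w, 0 ≤ (star w ⬝ᵥ (N *ᵥ w)).re := fun w => by
    rw [hformN]
    have := hlo w
    linarith
  have hρv : ∑ i, ρ i * ‖v i‖ ^ 2 = 0 := sum_eq_zero fun i _ => by
    by_cases h : ρ i = 0
    · rw [h, zero_mul]
    · rw [hv i h, norm_zero, zero_pow two_ne_zero, mul_zero]
  have hv0 : (star v ⬝ᵥ (N *ᵥ v)).re = 0 := by
    refine le_antisymm ?_ (hpos v)
    rw [hformN, hρv, mul_zero, add_zero]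
    have := hup v
    rw [hρv, mul_zero] at this
    exact this
  have hNv := mulVec_eq_zero_of_re_form_eq_zero hNh hpos hv0
  have hDv : D *ᵥ v = 0 := by
    funext i
    rw [hD, Matrix.mulVec_diagonal, Pi.zero_apply]
    by_cases h : ρ i = 0
    · rw [h, mul_zero, Complex.ofReal_zero, zero_mul]
    · rw [hv i h, mul_zero]
  have e : Y *ᵥ v = N *ᵥ v - D *ᵥ v := by rw [hN, Matrix.add_mulVec, add_sub_cancel_right]
  rw [e, hNv, hDv, sub_zero]

/-- the row version: under the same bounds, `(Yu)_i = 0` at every index off `supp ρ` (columns by the kernel lemma, rows by Hermitian symmetry).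
[folklore] -/
theorem mulVec_apply_eq_zero_of_weighted_form {Y : Matrix m m ℂ} (hY : Y.IsHermitian) {ρ : m → ℝ} {α β : ℝ}
    (hup : ∀ w, (star w ⬝ᵥ (Y *ᵥ w)).re ≤ β * ∑ i, ρ i * ‖w i‖ ^ 2)
    (hlo : ∀ w, -(α * ∑ i, ρ i * ‖w i‖ ^ 2) ≤ (star w ⬝ᵥ (Y *ᵥ w)).re)
    (u : m → ℂ) {i : m} (hi : ρ i = 0) : (Y *ᵥ u) i = 0 := by
  have hcol : Y *ᵥ (Pi.single i 1) = 0 :=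
    mulVec_eq_zero_of_weighted_form hY hup hlo fun j hj => Pi.single_eq_of_ne (show j ≠ i from fun h => hj (by rw [h]; exact hi)) _
  simp only [Matrix.mulVec, dotProduct]
  refine sum_eq_zero fun j _ => ?_
  have h1 : Y j i = 0 := by
    have := congrFun hcol j
    rwa [Matrix.mulVec_single_one, Matrix.col_apply, Pi.zero_apply] at this
  rw [← hY.apply i j, h1, star_zero, zero_mul]

end Generic

/-! ## §1 The corner coupling is supported on the corner bonds -/

section Region

variable (n : ℕ) [NeZero n] (M : Fin d → ℕ) [hM : ∀ μ, NeZero (M μ)] (S : Tor M → Prop) [DecidablePred S]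

/-- the corner weight of a STAR bond is `0` or `1`. [folklore] -/
theorem cornerWt_eq_zero_or_one (y : {b // starReg n M S b}) : cornerWt n M S y.1 = 0 ∨ cornerWt n M S y.1 = 1 := by
  obtain ⟨⟨x, ν⟩, hy⟩ := y
  unfold cornerWt bdW
  rcases hy with hx | hz
  · simp only
    rw [if_pos (show blockReg n M S x from hx), add_zero]
    split_ifs <;> simp
  · simp only
    rw [if_pos (show blockReg n M S (x + unitVec (fine n M) ν) from hz), zero_add]
    split_ifs <;> simp

/-- **`C v = 0` FOR EVERY `v` VANISHING ON THE CORNER BONDS** (`2 ≤ n`, any union of blocks). [folklore] -/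
theorem cornerC_mulVec_eq_zero_of_vanish (hn : 2 ≤ n) {v : {b // starReg n M S b} → ℂ}
    (hv : ∀ y, cornerWt n M S y.1 ≠ 0 → v y = 0) : cornerC n M S *ᵥ v = 0 :=
  mulVec_eq_zero_of_weighted_form (cornerC_isHermitian n M S) (ρ := fun y => cornerWt n M S y.1)
    (α := ((d - 1 : ℕ) : ℝ) * (n : ℝ) ^ 2) (β := (n : ℝ) ^ 2) (form_cornerC_le n M S hn) (form_cornerC_ge n M S hn) hv

/-- **`(C u)_y = 0` AT EVERY NON-CORNER BOND `y`**, for every `u` (`2 ≤ n`). [folklore] -/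
theorem cornerC_mulVec_apply_eq_zero (hn : 2 ≤ n) (u : {b // starReg n M S b} → ℂ) {y : {b // starReg n M S b}}
    (hy : cornerWt n M S y.1 = 0) : (cornerC n M S *ᵥ u) y = 0 :=
  mulVec_apply_eq_zero_of_weighted_form (cornerC_isHermitian n M S) (ρ := fun y => cornerWt n M S y.1)
    (α := ((d - 1 : ℕ) : ℝ) * (n : ℝ) ^ 2) (β := (n : ℝ) ^ 2) (form_cornerC_le n M S hn) (form_cornerC_ge n M S hn) u hy

/-- entrywise support, rows: `C y y′ = 0` if `y` is not a corner bond. [folklore] -/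
theorem cornerC_apply_eq_zero_left (hn : 2 ≤ n) {y : {b // starReg n M S b}} (hy : cornerWt n M S y.1 = 0)
    (y' : {b // starReg n M S b}) : cornerC n M S y y' = 0 := by
  have := cornerC_mulVec_apply_eq_zero n M S hn (Pi.single y' 1) hy
  rwa [Matrix.mulVec_single_one, Matrix.col_apply] at this

/-- entrywise support, columns: `C y y′ = 0` if `y′` is not a corner bond. [folklore] -/
theorem cornerC_apply_eq_zero_right (hn : 2 ≤ n) (y : {b // starReg n M S b}) {y' : {b // starReg n M S b}}
    (hy' : cornerWt n M S y'.1 = 0) : cornerC n M S y y' = 0 := by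
  rw [← (cornerC_isHermitian n M S).apply y y', cornerC_apply_eq_zero_left n M S hn hy' y, star_zero]

/-- **THE CORNER PROJECTION** `P_corner = diag(cornerWt)` (a `0/1` diagonal on the star bonds). [folklore] -/
def cornerP : Matrix {b // starReg n M S b} {b // starReg n M S b} ℂ := Matrix.diagonal fun y => ((cornerWt n M S y.1 : ℝ) : ℂ)

/-- **`C = P_corner·C·P_corner`** (`2 ≤ n`, any union of blocks). [folklore] -/
theorem cornerC_eq_proj_mul_proj (hn : 2 ≤ n) : cornerC n M S = cornerP n M S * cornerC n M S * cornerP n M S := by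
  ext y y'
  rw [cornerP, Matrix.mul_diagonal, Matrix.diagonal_mul]
  rcases cornerWt_eq_zero_or_one n M S y with h0 | h1
  · rw [cornerC_apply_eq_zero_left n M S hn h0 y', mul_zero, zero_mul]
  · rcases cornerWt_eq_zero_or_one n M S y' with h0' | h1'
    · rw [cornerC_apply_eq_zero_right n M S hn y h0', mul_zero, zero_mul]
    · rw [h1, h1', Complex.ofReal_one, one_mul, mul_one]

/-- the mass of the corner restriction: `‖P_corner u‖² = Σ_y cornerWt y·‖u y‖²`. [folklore] -/
theorem nsq_cornerP_mulVec (u : {b // starReg n M S b} → ℂ) :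
    nsq (cornerP n M S *ᵥ u) = ∑ y : {b // starReg n M S b}, cornerWt n M S y.1 * ‖u y‖ ^ 2 := by
  unfold nsq
  refine sum_congr rfl fun y _ => ?_
  rw [cornerP, Matrix.mulVec_diagonal, norm_mul, mul_pow, Complex.norm_real, Real.norm_eq_abs, abs_of_nonneg (cornerWt_nonneg n M S y.1)]
  rcases cornerWt_eq_zero_or_one n M S y with h | h <;> rw [h] <;> norm_num

/-- **`C u = C (P_corner u)`**: the corner coupling reads the corner restriction only (`2 ≤ n`). [folklore] -/
theorem cornerC_mulVec_eq_mulVec_proj (hn : 2 ≤ n) (u : {b // starReg n M S b} → ℂ) :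
    cornerC n M S *ᵥ u = cornerC n M S *ᵥ (cornerP n M S *ᵥ u) := by
  have h : cornerC n M S *ᵥ (u - cornerP n M S *ᵥ u) = 0 :=
    cornerC_mulVec_eq_zero_of_vanish n M S hn fun y hy => by
      rw [Pi.sub_apply, cornerP, Matrix.mulVec_diagonal]
      rcases cornerWt_eq_zero_or_one n M S y with h0 | h1
      · exact absurd h0 hy
      · rw [h1, Complex.ofReal_one, one_mul, sub_self]
  rwa [Matrix.mulVec_sub, sub_eq_zero] at h

/-- **THE END — `‖C u‖² ≤ ((d − 1)·n²)²·Σ_corner ‖u‖²`** (`2 ≤ n`, any union of blocks; truncated `d − 1`): the corner coupling of the local electric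
operator is an operator of norm `≤ (d − 1)n²` from the corner bonds to the corner bonds, and nothing else. [folklore] -/
theorem nsq_cornerC_mulVec_le (hn : 2 ≤ n) (u : {b // starReg n M S b} → ℂ) :
    nsq (cornerC n M S *ᵥ u)
      ≤ (((d - 1 : ℕ) : ℝ) * (n : ℝ) ^ 2) ^ 2 * ∑ y : {b // starReg n M S b}, cornerWt n M S y.1 * ‖u y‖ ^ 2 := by
  rw [cornerC_mulVec_eq_mulVec_proj n M S hn u, ← nsq_cornerP_mulVec]
  refine (nsq_mulVec_le _ _).trans ?_
  exact mul_le_mul_of_nonneg_right (pow_le_pow_left₀ (norm_nonneg _) (opNorm_cornerC_le n M S hn) 2) (nsq_nonneg _)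

/-- `P_corner (C u) = C u`: the output of the corner coupling is a corner field (`2 ≤ n`). [folklore] -/
theorem cornerP_mulVec_cornerC_mulVec (hn : 2 ≤ n) (u : {b // starReg n M S b} → ℂ) :
    cornerP n M S *ᵥ (cornerC n M S *ᵥ u) = cornerC n M S *ᵥ u := by
  funext y
  rw [cornerP, Matrix.mulVec_diagonal]
  rcases cornerWt_eq_zero_or_one n M S y with h0 | h1
  · rw [cornerC_mulVec_apply_eq_zero n M S hn u h0, mul_zero]
  · rw [h1, Complex.ofReal_one, one_mul]

/-- and the corner FORM reads the corner restriction only: `⟨A, C A⟩ = ⟨P A, C (P A)⟩` (`2 ≤ n`). [folklore] -/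
theorem form_cornerC_eq_proj (hn : 2 ≤ n) (A : {b // starReg n M S b} → ℂ) :
    star A ⬝ᵥ (cornerC n M S *ᵥ A) = star (cornerP n M S *ᵥ A) ⬝ᵥ (cornerC n M S *ᵥ (cornerP n M S *ᵥ A)) := by
  have hP : (cornerP n M S).IsHermitian := Matrix.isHermitian_diagonal_iff.mpr fun y => by simp [isSelfAdjoint_iff]
  rw [← cornerC_mulVec_eq_mulVec_proj n M S hn A, Matrix.star_mulVec, ← Matrix.dotProduct_mulVec, hP.eq,
    cornerP_mulVec_cornerC_mulVec n M S hn A]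

end Region

end Summit.QuantumFields.BalabanUV.T4Continuum.RegionCornerCouplingSupport

end
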